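import Summits.CriticalPhenomena.PercolationContinuityZ3.Theorems.Transplant.WeightedConeSchedule
import HarnessLib

/-!
# WEIGHTED CONES of `ℤ³` — VI: the CONSTANTS and THRESHOLDS of the exit datum (climb length, arm slope, move cap, station parameter, number of
# moves, window) and the gap-to-station estimate, for `𝕂_{v,τ,h} = {h ≤ ⟨v,x⟩, vⱼxᵢ − vᵢxⱼ ≤ τ⟨v,x⟩}`

builds on p205010 (kernel theorem, internal audit signed; external expert review pending) — NOT used in this file.
Lane `prim-bschramm`, seat `prim-bschramm-p2` (gen 30; class C1b = sub-domains of `ℤ³` at their own critical point, METHOD = input substitution;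
memo `HOME/bschramm/P2-LATTICES.md` §106); helper file (`--supports stmt-CriticalPhenomena-4575 --as helper`).

This file fixes the constants used by `Transplant/WeightedConeUniqueness` and proves the two real-arithmetic lemmas **`thresholds`** (for
`N ≥ N₀`: `A_N ≥ 1`, `(A_N + k)K ≤ τN`, `K(A_N + ⌊A_N/m⌋) ≤ τN`, `E₀ + τGN + 3A_N < (J+1)A_N`) and **`tgt_gap`** (a cone point of height in
`(N, H₁]` lies below the station `⌈R_N v⌉` with `⟨v,v⟩·gapⱼ ≤ vⱼ(c+1)K + τH₁S(vⱼ/κ + 1) + ⟨v,v⟩`).  THE RESULTS they serve, for the weighted cone `𝕂 = 𝕂_{v,τ,h} = {x ∈ ℤ³ | h ≤ ⟨v,x⟩, vⱼxᵢ − vᵢxⱼ ≤ τ⟨v,x⟩ ∀ i,j}` (`0 < κ ≤ vᵢ ≤ K ≤ τh`, `τ > 0`; simplicial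
cross-section around the real direction `v`; for small `τ` it contains no direction of any coordinate plane):
* **`cone_ae_numInfiniteClusters_le_one_of_supercritical`** (EVERY aperture `τ > 0`): above `p_c(ℤ³)` bond percolation on `ℤ³[𝕂]` has a.s. at most one
  infinite cluster.  Aizenman–Chayes–Chayes–Fröhlich–Russo in station form (`TubeSlabUniq.ae_numInfiniteClusters_le_one_of_station`) on the HEIGHT cut
  sets `{⟨v,x⟩ ≤ N}` (`WeightedConeExits`) with the lattice station `Ω_N = ⌈R_N v⌉`: an exit ESCAPES to its cone neighbour above level `N`, CLIMBS
  `c = ⌈kK/(τκ)⌉` argmin-ratio steps (slack `kK`), then the GREEDY SCHEDULE (`WeightedConeSchedule.schedule`) of `J` raise-the-minimal-ratio link moves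
  with thin steep arms of slope `1/(2m)`, `m = ⌈K/κ⌉` (`WeightedConeMove.raise_datum`; cap `A_N = ⌊τN/2K⌋ − k`) reaches `Ω_N`: the potential after the
  climb is `≤ E₀ + τGN + 3A_N < (J+1)A_N` for `J = ⌈4KG⌉ + 3`, `G = S(S/κ+3)/⟨v,v⟩`, `S = Σvᵢ` (`thresholds`, `inv_climb`); probability
  `≥ (α₂α)ᴶ`, `≤ c + 1 + Jk` extra edges, uniformly in the exit — Grimmett–Marstrand supplies `k` with `p_c(S_k) < p'`, gen 23's
  `SectorSlab.exists_armM_bound` the thin arms.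
* **`cone_uniqueness`** (`τ(v₁+v₂) ≤ v₀`): a.s. at most one infinite cluster at EVERY density (at and below `p_c(ℤ³) = p_c(𝕂)`: none, BGN via `𝕂 ⊆ ℍ`);
  **`cone_numInfiniteClusters_eq_one`**, **`continuous_theta_cone`** (van den Berg–Keane), **`cone_row_complete`** (all four columns at every vertex),
  `cone_ae_numInfiniteClusters_le_one_of_ne` (every `τ`: uniqueness at every `p ≠ p_c`).
In print: Chayes–Chayes 1986 / Grimmett 1999 §11.5 treat the critical point of wedges and cones; uniqueness and continuity columns for a
three-dimensional cone around a general direction: not located.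
[cite: AizenmanChayesChayesFrohlichRusso1983, §4 Thm 4.4, Lemma 4.2 (a), Lemma 4.3] [cite: BarskyGrimmettNewman1991, Thm 1.1 and Cor. (ii)–(iv)]
[cite: DuminilCopinSidoraviciusTassion2016, Thm. 1 and §2] [cite: GrimmettPercolation1999, Thm. (7.2) p. 148; §8.3 Thm (8.8) p. 202; §11.5 notes p. 347]
[cite: ChayesChayes1986Wedges, Thm. 1] -/

noncomputable section

namespace Summit.CriticalPhenomena.PercolationContinuityZ3.Theorems.Transplant

namespace WCone

open MeasureTheory Literature.Probability.Percolation Literature.Probability.LatticeModels SimpleGraph HSU OrthantUniq HalfSlabUniq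
  TubeSlabUniq DesignTransport WallUniq DiagCone SectorSlab ConeSlabUniq Filter
open scoped Classical Topology

/-! ## §1 The constants of the exit datum at level `N` -/

/-- The arm slope parameter `m = ⌈K/κ⌉` (thin steep arms of slope `1/(2m)`). [folklore] -/
def armM (κ K : ℝ) : ℕ := ⌈K / κ⌉₊

/-- The climb length `c = ⌈kK/(τκ)⌉` (slack `cτκ ≥ kK`). [folklore] -/
def climbN (κ K τ : ℝ) (k : ℕ) : ℕ := ⌈(k : ℝ) * K / (τ * κ)⌉₊

/-- The move cap `A_N = ⌊τN/(2K)⌋ − k`. [folklore] -/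
def capN (K τ : ℝ) (k N : ℕ) : ℕ := ⌊τ * (N : ℝ) / (2 * K)⌋₊ - k

/-- `S = v₀ + v₁ + v₂`. [folklore] -/
def sumv (v : Fin 3 → ℝ) : ℝ := v 0 + v 1 + v 2

/-- `⟨v,v⟩ = v₀² + v₁² + v₂²`. [folklore] -/
def nsq (v : Fin 3 → ℝ) : ℝ := v 0 * v 0 + v 1 * v 1 + v 2 * v 2

/-- The potential growth constant `G = S(S/κ + 3)/⟨v,v⟩`. [folklore] -/
def Gconst (v : Fin 3 → ℝ) (κ : ℝ) : ℝ := sumv v * (sumv v / κ + 3) / nsq v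

/-- The number of moves `J = ⌈4KG⌉ + 3`. [folklore] -/
def movesJ (v : Fin 3 → ℝ) (κ K : ℝ) : ℕ := ⌈4 * K * Gconst v κ⌉₊ + 3

/-- The top height after escape and climb `H₁ = N + (c + 1)K`. [folklore] -/
def topH (κ K τ : ℝ) (k N : ℕ) : ℝ := (N : ℝ) + ((climbN κ K τ k : ℝ) + 1) * K

/-- The station parameter `R_N = H₁(1 + τS/κ)/⟨v,v⟩` (station `Ω_N = ⌈R_N v⌉`). [folklore] -/
def stR (v : Fin 3 → ℝ) (κ K τ : ℝ) (k N : ℕ) : ℝ := topH κ K τ k N * (1 + τ * sumv v / κ) / nsq v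

/-- The constant part of the potential bound `E₀ = (c+1)KS/⟨v,v⟩ + 3 + τG(c+1)K`. [folklore] -/
def E0 (v : Fin 3 → ℝ) (κ K τ : ℝ) (k : ℕ) : ℝ :=
  ((climbN κ K τ k : ℝ) + 1) * K * sumv v / nsq v + 3 + τ * Gconst v κ * (((climbN κ K τ k : ℝ) + 1) * K)

/-- The threshold `N₀ = 2K(E₀ + (⌈4KG⌉ + 1)(k + 1))/τ + 1`. [folklore] -/
def threshN (v : Fin 3 → ℝ) (κ K τ : ℝ) (k : ℕ) : ℝ :=
  2 * K * (E0 v κ K τ k + ((⌈4 * K * Gconst v κ⌉₊ : ℝ) + 1) * ((k : ℝ) + 1)) / τ + 1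

/-- The window `M_N = A_N + ⌊A_N/m⌋ + k + Q_{R_N} + (B_N + c + 1)`. [folklore] -/
def window (v : Fin 3 → ℝ) (κ K τ : ℝ) (k N : ℕ) : ℕ :=
  capN K τ k N + capN K τ k N / armM κ K + k + winQ v τ K (stR v κ K τ k N) + (boxR v τ K N + climbN κ K τ k + 1)

section Cone

variable {v : Fin 3 → ℝ} {κ K τ h : ℝ} (hκ : 0 < κ) (hvκ : ∀ i, κ ≤ v i) (hvK : ∀ i, v i ≤ K) (hτ : 0 < τ) (hh : K ≤ τ * h)
  {D : Set (Site 3)} (hCD : ∀ x : Site 3, x ∈ D ↔ h ≤ hgt v x ∧ ∀ i j : Fin 3, dev v x i j ≤ τ * hgt v x)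
  {k : ℕ}

include hκ hvκ hvK in
/-- `m = ⌈K/κ⌉ ≥ 1` and `K ≤ mκ`. [folklore] -/
theorem armM_props : 1 ≤ armM κ K ∧ K ≤ (armM κ K : ℝ) * κ := by
  have hK : 0 < K := (v_pos hκ hvκ 0).trans_le (hvK 0)
  have h1 : K / κ ≤ (armM κ K : ℝ) := Nat.le_ceil _
  refine ⟨Nat.one_le_iff_ne_zero.2 (Nat.pos_iff_ne_zero.1 (Nat.ceil_pos.2 (div_pos hK hκ))), ?_⟩
  have := mul_le_mul_of_nonneg_right h1 hκ.le
  rwa [div_mul_cancel₀ _ hκ.ne'] at this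

include hκ hτ in
/-- `cτκ ≥ kK`. [folklore] -/
theorem climbN_slack : (k : ℝ) * K ≤ (climbN κ K τ k : ℝ) * (τ * κ) := by
  have h1 : (k : ℝ) * K / (τ * κ) ≤ (climbN κ K τ k : ℝ) := Nat.le_ceil _
  have h2 := mul_le_mul_of_nonneg_right h1 (mul_pos hτ hκ).le
  rwa [div_mul_cancel₀ _ (mul_pos hτ hκ).ne'] at h2

include hκ hvκ hvK in
/-- Positivity of the constants: `S ≥ 3κ > 0`, `⟨v,v⟩ > 0`, `κS ≤ ⟨v,v⟩`, `G ≥ 0`, `E₀ ≥ 3`, `K > 0`. [folklore] -/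
theorem consts_pos : 0 < sumv v ∧ 0 < nsq v ∧ 0 ≤ Gconst v κ ∧ 3 ≤ E0 v κ K τ k ∨ τ ≤ 0 := by
  by_cases hτ0 : τ ≤ 0
  · exact Or.inr hτ0
  left
  push Not at hτ0
  have h0 := v_pos hκ hvκ 0; have h1 := v_pos hκ hvκ 1; have h2 := v_pos hκ hvκ 2
  have hK : 0 < K := h0.trans_le (hvK 0)
  have hS : 0 < sumv v := by unfold sumv; positivity
  have hV : 0 < nsq v := by unfold nsq; positivity
  have hG : 0 ≤ Gconst v κ := by unfold Gconst; positivity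
  refine ⟨hS, hV, hG, ?_⟩
  unfold E0
  have : 0 ≤ ((climbN κ K τ k : ℝ) + 1) * K * sumv v / nsq v := by positivity
  have : 0 ≤ τ * Gconst v κ * (((climbN κ K τ k : ℝ) + 1) * K) := by positivity
  linarith

include hκ hvκ hvK hτ in
/-- **The thresholds.**  For `N ≥ N₀`: `A_N ≥ 1`, `(A_N + k)K ≤ τN`, `K(A_N + ⌊A_N/m⌋) ≤ τN`, and `E₀ + τGN + 3A_N < (J+1)A_N`. [folklore] -/
theorem thresholds {N : ℕ} (hN : threshN v κ K τ k ≤ N) :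
    1 ≤ capN K τ k N ∧ (((capN K τ k N : ℝ) + k) * K ≤ τ * N) ∧
      (K * ((capN K τ k N + capN K τ k N / armM κ K : ℕ) : ℝ) ≤ τ * N) ∧
      (E0 v κ K τ k + τ * Gconst v κ * N + 3 * capN K τ k N < ((movesJ v κ K : ℝ) + 1) * capN K τ k N) := by
  obtain ⟨hS, hV, hG, hE3⟩ | hτ0 := consts_pos (τ := τ) (k := k) hκ hvκ hvK
  swap; · exact absurd hτ0 (not_le.2 hτ)
  have hK : 0 < K := (v_pos hκ hvκ 0).trans_le (hvK 0)
  have hN0 : (0 : ℝ) ≤ N := by positivity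
  -- `x = τN/(2K)`
  set x : ℝ := τ * (N : ℝ) / (2 * K) with hxdef
  have hx : 2 * K * x = τ * N := by rw [hxdef]; field_simp
  have hx0 : 0 ≤ x := by positivity
  set J₂ : ℝ := (⌈4 * K * Gconst v κ⌉₊ : ℝ) + 1 with hJ₂
  have hJ₂ge : 4 * K * Gconst v κ + 1 ≤ J₂ := by have := Nat.le_ceil (4 * K * Gconst v κ); rw [hJ₂]; linarith
  have hc0 : (0 : ℝ) ≤ ⌈4 * K * Gconst v κ⌉₊ := by positivity
  have hJ₂1 : 1 ≤ J₂ := by rw [hJ₂]; linarith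
  have hk0 : (0 : ℝ) ≤ k := by positivity
  -- the threshold unpacked: `x > E₀ + J₂(k+1)`
  have hthr : E0 v κ K τ k + J₂ * ((k : ℝ) + 1) < x := by
    have h1 : 2 * K * (E0 v κ K τ k + J₂ * ((k : ℝ) + 1)) / τ + 1 ≤ N := hN
    have h2 : 2 * K * (E0 v κ K τ k + J₂ * ((k : ℝ) + 1)) / τ * τ = 2 * K * (E0 v κ K τ k + J₂ * ((k : ℝ) + 1)) :=
      div_mul_cancel₀ _ hτ.ne'
    have h3 : (2 * K * (E0 v κ K τ k + J₂ * ((k : ℝ) + 1)) / τ + 1) * τ ≤ (N : ℝ) * τ := mul_le_mul_of_nonneg_right h1 hτ.le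
    have h4 : 2 * K * (E0 v κ K τ k + J₂ * ((k : ℝ) + 1)) + τ ≤ τ * N := by nlinarith
    have h5 : 2 * K * (E0 v κ K τ k + J₂ * ((k : ℝ) + 1)) + τ ≤ 2 * K * x := by rw [hx]; exact h4
    nlinarith
  have hxk : (k : ℝ) + 2 ≤ x := by nlinarith
  -- the floor
  have hfl : (⌊x⌋₊ : ℝ) ≤ x := Nat.floor_le hx0
  have hfl' : x < (⌊x⌋₊ : ℝ) + 1 := Nat.lt_floor_add_one x
  have hflk : k + 1 ≤ ⌊x⌋₊ := by
    have : ((k : ℝ) + 1) < (⌊x⌋₊ : ℝ) + 1 := by linarith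
    have : (k : ℝ) < ⌊x⌋₊ := by linarith
    exact_mod_cast this
  have hcap_def : capN K τ k N = ⌊x⌋₊ - k := rfl
  have hA1 : 1 ≤ capN K τ k N := by rw [hcap_def]; omega
  have hAk : ((capN K τ k N : ℝ) + k) = ⌊x⌋₊ := by
    have : capN K τ k N + k = ⌊x⌋₊ := by rw [hcap_def]; omega
    exact_mod_cast this
  have hAx : (capN K τ k N : ℝ) + k ≤ x := by rw [hAk]; exact hfl
  have hAlo : x - k - 1 ≤ capN K τ k N := by linarith
  have hA0 : (0 : ℝ) ≤ capN K τ k N := by positivity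
  refine ⟨hA1, by nlinarith, ?_, ?_⟩
  · -- `K(A + ⌊A/m⌋) ≤ 2KA ≤ 2Kx = τN`
    have h1 : capN K τ k N + capN K τ k N / armM κ K ≤ 2 * capN K τ k N := by
      have := Nat.div_le_self (capN K τ k N) (armM κ K); omega
    have h2 : ((capN K τ k N + capN K τ k N / armM κ K : ℕ) : ℝ) ≤ 2 * capN K τ k N := by exact_mod_cast h1
    nlinarith
  · -- `E₀ + τGN < J₂·A`, `J = J₂ + 2`
    have hJ : (movesJ v κ K : ℝ) + 1 = J₂ + 3 := by simp only [movesJ, hJ₂]; push_cast; ring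
    rw [hJ]
    have hGN : 0 ≤ τ * Gconst v κ * N := by positivity
    have h1 : J₂ * (x - k - 1) ≤ J₂ * capN K τ k N := mul_le_mul_of_nonneg_left hAlo (by linarith)
    have h2 : (4 * K * Gconst v κ + 1) * x ≤ J₂ * x := mul_le_mul_of_nonneg_right hJ₂ge hx0
    have h3 : 4 * K * Gconst v κ * x = 2 * (τ * Gconst v κ * N) := by
      calc 4 * K * Gconst v κ * x = 2 * Gconst v κ * (2 * K * x) := by ring
        _ = 2 * (τ * Gconst v κ * N) := by rw [hx]; ring
    nlinarith

/-! ## §2 The gap to the station -/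

include hκ hvκ hvK hτ hCD in
/-- **The gap to the station.**  If `P ∈ 𝕂` with `N < H(P) ≤ H₁` then, with `R = R_N`: `Pⱼ ≤ ⌈Rvⱼ⌉` and
`⟨v,v⟩(⌈Rvⱼ⌉ − Pⱼ) ≤ vⱼ(c+1)K + τH₁S(vⱼ/κ + 1) + ⟨v,v⟩` (from `|⟨v,v⟩Pⱼ − vⱼH| ≤ τHS`). [folklore] -/
theorem tgt_gap {N : ℕ} {P : Site 3} (hP : P ∈ D) (hlo : (N : ℝ) < hgt v P) (hhi : hgt v P ≤ topH κ K τ k N) (j : Fin 3) :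
    P j ≤ tgt v (stR v κ K τ k N) j ∧
      nsq v * ((tgt v (stR v κ K τ k N) j : ℝ) - P j) ≤
        v j * (((climbN κ K τ k : ℝ) + 1) * K) + τ * topH κ K τ k N * sumv v * (v j / κ + 1) + nsq v := by
  obtain ⟨hS, hV, -, -⟩ | hτ0 := consts_pos (τ := τ) (k := k) hκ hvκ hvK
  swap; · exact absurd hτ0 (not_le.2 hτ)
  have hvj := v_pos hκ hvκ j; have hκj := hvκ j
  obtain ⟨c1, c2⟩ := coord_bounds hκ hvκ hCD hP j
  have hN0 : (0 : ℝ) ≤ N := by positivity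
  have hK : 0 < K := (v_pos hκ hvκ 0).trans_le (hvK 0)
  have hH1 : 0 ≤ topH κ K τ k N := by unfold topH; positivity
  have hH1N : v j * topH κ K τ k N - v j * N = v j * (((climbN κ K τ k : ℝ) + 1) * K) := by unfold topH; ring
  have hRV : stR v κ K τ k N * v j * nsq v = topH κ K τ k N * v j + τ * topH κ K τ k N * sumv v * (v j / κ) := by
    unfold stR; field_simp
  have hjκ : 1 ≤ v j / κ := by rw [le_div_iff₀ hκ, one_mul]; exact hκj
  -- monotone steps
  have s1 : v j * hgt v P ≤ v j * topH κ K τ k N := mul_le_mul_of_nonneg_left hhi hvj.le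
  have s2 : τ * sumv v * hgt v P ≤ τ * sumv v * topH κ K τ k N := mul_le_mul_of_nonneg_left hhi (mul_pos hτ hS).le
  have s3 : τ * topH κ K τ k N * sumv v ≤ τ * topH κ K τ k N * sumv v * (v j / κ) :=
    le_mul_of_one_le_right (by positivity) hjκ
  have s4 : v j * (N : ℝ) ≤ v j * hgt v P := mul_le_mul_of_nonneg_left hlo.le hvj.le
  unfold nsq at hV hRV ⊢
  unfold sumv at s2 s3 hRV ⊢
  -- (i) `V Pⱼ ≤ V R vⱼ`
  have hup : (v 0 * v 0 + v 1 * v 1 + v 2 * v 2) * (P j : ℝ) ≤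
      (v 0 * v 0 + v 1 * v 1 + v 2 * v 2) * (stR v κ K τ k N * v j) := by linarith
  have hle : (P j : ℝ) ≤ stR v κ K τ k N * v j := le_of_mul_le_mul_left hup hV
  have hceil : stR v κ K τ k N * v j ≤ ((tgt v (stR v κ K τ k N) j : ℤ) : ℝ) ∧
      ((tgt v (stR v κ K τ k N) j : ℤ) : ℝ) < stR v κ K τ k N * v j + 1 :=
    ⟨by rw [tgt_apply]; exact Int.le_ceil _, by rw [tgt_apply]; exact Int.ceil_lt_add_one _⟩
  refine ⟨by exact_mod_cast hle.trans hceil.1, ?_⟩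
  -- (ii) the gap
  have e1 : (v 0 * v 0 + v 1 * v 1 + v 2 * v 2) * ((tgt v (stR v κ K τ k N) j : ℤ) : ℝ) ≤
      (v 0 * v 0 + v 1 * v 1 + v 2 * v 2) * (stR v κ K τ k N * v j + 1) := mul_le_mul_of_nonneg_left hceil.2.le hV.le
  linarith

/-- A coordinate potential is at most gap plus `A`. [folklore] -/
theorem gapA_le (A : ℕ) (T P : ℤ) : gapA A T P ≤ (T - P) + A := by
  unfold gapA; split_ifs <;> omega

end Cone

end WCone

end Summit.CriticalPhenomena.PercolationContinuityZ3.Theorems.Transplant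

end
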